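import Literature.NumberTheory.LFunctions.WeilTwoPrimeCellsT80
import Literature.NumberTheory.LFunctions.WeilTwoPrimeMinorant
import Literature.NumberTheory.LFunctions.WeilTwoPrimeCellsT80Check0
import Literature.NumberTheory.LFunctions.WeilTwoPrimeCellsT80Check1
import Literature.NumberTheory.LFunctions.WeilTwoPrimeCellsT80Check2
import HarnessLib

/-!
# Two-prime minorant cells on `[0, 80]`: `checkCells₂₃ = true` (assembly)

The integer chain check `checkCells₂₃ 120 5 wL 80 40000 weilTwoPrimeCellsT80` from its kernel-checked parts: the chain test, the per-chunk cell checks, the dyadic representation of `T` and the level test `wL + cZeroFI.hiQ + cThreeFI.hiQ ≤ wLoZ 120 (dyNum 80 5) 5 40000`. Pure proof file.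
-/

noncomputable section

namespace Literature.NumberTheory.LFunctions

/-- The chain test (cheap). [folklore] -/
theorem checkChain_weilTwoPrimeCellsT80 : checkChain₂₃ weilTwoPrimeCellsT80 0 80 = true := by
  decide +kernel

set_option maxHeartbeats 0 in
/-- The level test at `T = 80` against the integer digamma bound. [folklore] -/
theorem checkLevel_weilTwoPrimeCellsT80 :
    decide (weilTwoPrimeCellsT80Level + cZeroFI.hiQ + cThreeFI.hiQ ≤ wLoZ 120 2560 5 40000) = true := by
  decide +kernel

/-- `dyNum 80 5 = 2560`. [folklore] -/
theorem dyNumT_weilTwoPrimeCellsT80 : dyNum (80 : ℚ) 5 = 2560 := by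
  decide +kernel

/-- The dyadic representation test of `T`. [folklore] -/
theorem checkTdy_weilTwoPrimeCellsT80 : (decide (1 ≤ 5) && decide ((80 : ℚ) * 2 ^ 5 = ((dyNum (80 : ℚ) 5 : ℕ) : ℚ))) = true := by
  decide +kernel

/-- **`checkCells₂₃ = true` for the two-prime minorant on `[0, 80]`** (assembled). [folklore] -/
theorem checkCells₂₃_weilTwoPrimeCellsT80 :
    checkCells₂₃ 120 5 weilTwoPrimeCellsT80Level 80 40000 weilTwoPrimeCellsT80 = true := by
  have hall : (weilTwoPrimeCellsT80.all fun c ↦ c.checkZ 120 5) = true := by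
    simp only [weilTwoPrimeCellsT80, List.all_append, checkCells_weilTwoPrimeCellsT80C0,
      checkCells_weilTwoPrimeCellsT80C1, checkCells_weilTwoPrimeCellsT80C2, Bool.and_self]
  unfold checkCells₂₃
  rw [checkChain_weilTwoPrimeCellsT80, hall, dyNumT_weilTwoPrimeCellsT80, checkLevel_weilTwoPrimeCellsT80]
  have hd := checkTdy_weilTwoPrimeCellsT80
  rw [dyNumT_weilTwoPrimeCellsT80] at hd
  rw [Bool.true_and, Bool.true_and]
  simpa using hd

end Literature.NumberTheory.LFunctions
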